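import Mathlib
import Summits.ValiantsHypothesis.ValiantsHypothesis.Theorems.LacunarySymmetroidMatrixDescartesTieLawRootCount
import HarnessLib

/-!
# ValiantsHypothesis / LacunarySymmetroid — crux `MatrixDescartes` (stmt-ValiantsHypothesis-18050, V1), LINE (A) «product_plus_one»:
# the TIE LAW, kernel path Stage 2, part 2 — simple roots: isolation, first-order exit, persistence of real roots

`simple_root_isolated`: a simple root `z₀` of `A ∈ ℂ[X]` has a disc `‖z − z₀‖ < ρ` containing exactly one root of `A`
(with multiplicity) and no root on its boundary circle.  `exit_lemma`: for `A, B ∈ ℂ[X]`, a simple root `z₀` of `A` (`A(z₀) = 0`, `A′(z₀) ≠ 0`) and a direction `d ≠ 0`, put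
`v := −B(z₀)/A′(z₀)`.  If `0 < Im(v/d)` then there is `ρ > 0` such that for all sufficiently small `s > 0` every root
`z` of `A + s·B` with `‖z − z₀‖ < ρ` satisfies `0 < Im((z − z₀)/d)` — the root continuing `z₀` leaves the line
`z₀ + ℝ·d` on the side `v` points to.  Proof by two applications of Rouché's theorem for polynomials on circles
(`…TieLawRootCount`): against `A` on `B(z₀, ρ)` (one root) and against the linearisation `A′(z₀)·(X − z₀ − s v)` on the
disc `B(z₀ + s v, κ s)` (one root, and that disc lies in the open half-plane); only continuity of polynomial evaluation is
used — no implicit-function theorem.  This replaces the IFT step (45.3) of the pen's §45 proof of the tie law.  `real_root_persists`: for a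
family of REAL polynomials, near a simple real root of `Q i₀` the roots of `Q i` (`i` near `i₀`) are real (the unique
nearby complex root is its own conjugate) — used for the positive real root `σ` of the trinomial, which sits on the
boundary of the counting sector throughout the deformation.
HONEST FRAMING: helper lemma; no stub of LINE (A) is touched; `MatrixDescartes` OPEN; `VP ≠ VNP` is NOT proved.  No definitions,
no named facts.
-/

set_option linter.dupNamespace false

namespace Summit.ValiantsHypothesis.ValiantsHypothesis.Theorems.LacunarySymmetroidMatrixDescartes

namespace TieLaw

open Polynomial Filter Topology
open Literature.Analysis.Complex.Pellet

/-- A simple root has multiplicity one: `A(z₀) = 0`, `A′(z₀) ≠ 0` give `count z₀ A.roots = 1`. -/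
theorem count_roots_eq_one_of_derivative_ne_zero {A : ℂ[X]} {z₀ : ℂ} (hz : A.IsRoot z₀)
    (ha : A.derivative.eval z₀ ≠ 0) : A.roots.count z₀ = 1 := by
  have hA : A ≠ 0 := fun h => ha (by rw [h, derivative_zero, eval_zero])
  rw [count_roots]
  have hpos : 0 < A.rootMultiplicity z₀ := (rootMultiplicity_pos hA).2 hz
  by_contra hne
  have hder := derivative_rootMultiplicity_of_root hz
  have hd0 : A.derivative ≠ 0 := fun h => ha (by rw [h, eval_zero])
  have hpos' : 0 < A.derivative.rootMultiplicity z₀ := by rw [hder]; omega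
  exact ha ((rootMultiplicity_pos hd0).1 hpos')

/-- **Isolation of a simple root.**  If `A(z₀) = 0` and `A′(z₀) ≠ 0` there is `ρ > 0` such that every other root of `A`
is at distance `≥ 2ρ` from `z₀`; in particular `A` has no root on the circle `‖z − z₀‖ = ρ` and exactly one root, with
multiplicity, in the open disc `‖z − z₀‖ < ρ`. -/
theorem simple_root_isolated {A : ℂ[X]} {z₀ : ℂ} (hz : A.IsRoot z₀) (ha : A.derivative.eval z₀ ≠ 0) :
    ∃ ρ : ℝ, 0 < ρ ∧ (∀ w ∈ A.roots, w ≠ z₀ → 2 * ρ ≤ ‖w - z₀‖) ∧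
      (∀ z, ‖z - z₀‖ = ρ → A.eval z ≠ 0) ∧ (A.roots.filter fun z => ‖z - z₀‖ < ρ).card = 1 := by
  classical
  have hA : A ≠ 0 := fun h => ha (by rw [h, derivative_zero, eval_zero])
  obtain ⟨ρ, hρ, hρle⟩ := exists_pos_forall_le (A.roots.toFinset.erase z₀) (fun w => ‖w - z₀‖ / 2)
    (fun w hw => by
      have h := (Finset.mem_erase.1 hw).1
      have : 0 < ‖w - z₀‖ := norm_pos_iff.2 (sub_ne_zero.2 h)
      positivity)
  have hiso : ∀ w ∈ A.roots, w ≠ z₀ → 2 * ρ ≤ ‖w - z₀‖ := fun w hw hne => by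
    have := hρle w (Finset.mem_erase.2 ⟨hne, Multiset.mem_toFinset.2 hw⟩)
    linarith
  refine ⟨ρ, hρ, hiso, fun z hzρ h0 => ?_, ?_⟩
  · have hzr : z ∈ A.roots := (mem_roots hA).2 h0
    by_cases hne : z = z₀
    · rw [hne, sub_self, norm_zero] at hzρ
      exact hρ.ne' hzρ.symm
    · have := hiso z hzr hne
      linarith
  · have : (A.roots.filter fun z => ‖z - z₀‖ < ρ) = A.roots.filter (· = z₀) := by
      refine Multiset.filter_congr fun w hw => ⟨fun h => ?_, fun h => ?_⟩
      · by_contra hne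
        have := hiso w hw hne
        linarith
      · rw [h, sub_self, norm_zero]
        exact hρ
    rw [this, Multiset.filter_eq', Multiset.card_replicate]
    exact count_roots_eq_one_of_derivative_ne_zero hz ha

/-- **Exit lemma (first-order motion of a simple root).**  Let `z₀` be a simple root of `A ∈ ℂ[X]`
(`A(z₀) = 0`, `A′(z₀) ≠ 0`) and `d ≠ 0` a direction; put `v := −B(z₀)/A′(z₀)`.  If `0 < Im(v/d)` then there is
`ρ > 0` such that for all sufficiently small `s > 0` every root `z` of `A + s·B` with `‖z − z₀‖ < ρ` satisfies
`0 < Im((z − z₀)/d)`, i.e. lies strictly on the side of the line `z₀ + ℝ·d` into which `v` points.  Proof: Rouché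
against the linearisation `A′(z₀)·(X − z₀ − s v)` on the disc `B(z₀ + s v, κ s)` (one root there), and against `A` on
`B(z₀, ρ)` (one root there); only continuity of polynomial evaluation is used. -/
theorem exit_lemma {A B : ℂ[X]} {z₀ d : ℂ} (hz : A.IsRoot z₀) (ha : A.derivative.eval z₀ ≠ 0)
    (hd : d ≠ 0) (hv : 0 < (-(B.eval z₀ / A.derivative.eval z₀) / d).im) :
    ∃ ρ : ℝ, 0 < ρ ∧ ∀ᶠ s : ℝ in 𝓝[>] 0,
      ∀ z ∈ (A + C (s : ℂ) * B).roots, ‖z - z₀‖ < ρ → 0 < ((z - z₀) / d).im := by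
  classical
  set a := A.derivative.eval z₀ with ha_def
  set b := B.eval z₀ with hb_def
  set v := -(b / a) with hv_def
  have hb0 : b ≠ 0 := by
    intro h
    have hv00 : v = 0 := by rw [hv_def, h, zero_div, neg_zero]
    rw [hv00, zero_div, Complex.zero_im] at hv
    exact lt_irrefl _ hv
  -- the family and its continuity data
  set P : ℝ → ℂ[X] := fun s => A + C (s : ℂ) * B with hP
  set n := max A.natDegree B.natDegree with hn
  have hdeg : ∀ s, (P s).natDegree ≤ n := fun s => by
    refine (natDegree_add_le _ _).trans (max_le (le_max_left _ _) ?_)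
    exact (natDegree_C_mul_le _ _).trans (le_max_right _ _)
  have hcont : ∀ k, ContinuousAt (fun s => (P s).coeff k) 0 := fun k => by
    simp only [hP, coeff_add, coeff_C_mul]
    exact (continuous_const.add (Complex.continuous_ofReal.mul continuous_const)).continuousAt
  have hP0 : P 0 = A := by simp [hP]
  -- isolation radius ρ
  obtain ⟨ρ, hρ, -, hcircle, hone⟩ := simple_root_isolated hz ha
  refine ⟨ρ, hρ, ?_⟩
  have hdisc : ∀ᶠ s : ℝ in 𝓝 0, ((P s).roots.filter fun z => ‖z - z₀‖ < ρ).card = 1 := by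
    have h := card_roots_ball_eventually_eq (i₀ := (0 : ℝ)) hdeg hcont z₀ hρ (by rw [hP0]; exact hcircle)
    rw [hP0] at h
    exact h.mono fun s hs => hs.trans hone
  -- A = (X - z₀)·Â with Â(z₀) = a
  set Ah := A /ₘ (X - C z₀) with hAh
  have hfac : (X - C z₀) * Ah = A := mul_divByMonic_eq_iff_isRoot.2 hz
  have hAh0 : Ah.eval z₀ = a := by
    have hder : A.derivative = Ah + (X - C z₀) * Ah.derivative := by
      conv_lhs => rw [← hfac]
      rw [derivative_mul]
      simp
    rw [ha_def, hder, eval_add, eval_mul]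
    simp
  -- constants
  have ha' : 0 < ‖a‖ := norm_pos_iff.2 ha
  have hd' : 0 < ‖d‖ := norm_pos_iff.2 hd
  set h := (v / d).im with hh
  have hhpos : 0 < h := hv
  set κ := h * ‖d‖ / 2 with hκdef
  have hκ : 0 < κ := by positivity
  set ε₁ := ‖a‖ * κ / (4 * (‖v‖ + κ)) with hε₁
  set ε₂ := ‖a‖ * κ / 4 with hε₂
  have hvκ : 0 < ‖v‖ + κ := by positivity
  have hε₁pos : 0 < ε₁ := by positivity
  have hε₂pos : 0 < ε₂ := by positivity
  -- continuity of Â and B at z₀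
  obtain ⟨η, hη, hηb⟩ : ∃ η > 0, ∀ z, ‖z - z₀‖ < η → ‖Ah.eval z - a‖ < ε₁ ∧ ‖B.eval z - b‖ < ε₂ := by
    have h1 : ∀ᶠ z in 𝓝 z₀, ‖Ah.eval z - a‖ < ε₁ := by
      have ht : Tendsto (fun z => Ah.eval z) (𝓝 z₀) (𝓝 a) := by
        rw [← hAh0]; exact Ah.continuous.continuousAt
      have := Metric.tendsto_nhds.1 ht ε₁ hε₁pos
      simpa [dist_eq_norm] using this
    have h2 : ∀ᶠ z in 𝓝 z₀, ‖B.eval z - b‖ < ε₂ := by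
      have ht : Tendsto (fun z => B.eval z) (𝓝 z₀) (𝓝 b) := B.continuous.continuousAt
      have := Metric.tendsto_nhds.1 ht ε₂ hε₂pos
      simpa [dist_eq_norm] using this
    obtain ⟨η, hη, hball⟩ := Metric.eventually_nhds_iff.1 (h1.and h2)
    exact ⟨η, hη, fun z hz => hball (by simpa [dist_eq_norm] using hz)⟩
  -- small parameters
  have hsmall : ∀ᶠ s : ℝ in 𝓝[>] 0, 0 < s ∧ s * (‖v‖ + κ) < min η ρ := by
    have h1 : ∀ᶠ s : ℝ in 𝓝[>] 0, 0 < s := eventually_mem_nhdsWithin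
    have h2 : ∀ᶠ s : ℝ in 𝓝 0, s * (‖v‖ + κ) < min η ρ := by
      have ht : Tendsto (fun s : ℝ => s * (‖v‖ + κ)) (𝓝 0) (𝓝 (0 * (‖v‖ + κ))) :=
        tendsto_id.mul_const _
      rw [zero_mul] at ht
      exact (tendsto_order.1 ht).2 _ (lt_min hη hρ)
    exact h1.and (h2.filter_mono nhdsWithin_le_nhds)
  filter_upwards [hsmall, hdisc.filter_mono nhdsWithin_le_nhds] with s hs hds
  obtain ⟨hs0, hs1⟩ := hs
  intro z hz hzρ
  have hsη : s * (‖v‖ + κ) < η := hs1.trans_le (min_le_left _ _)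
  have hsρ : s * (‖v‖ + κ) < ρ := hs1.trans_le (min_le_right _ _)
  set c₀ := z₀ + (s : ℂ) * v with hc₀
  have hκs : 0 < κ * s := mul_pos hκ hs0
  -- points of the small disc: close to z₀ and on the good side
  have hsub : ∀ w, ‖w - c₀‖ < κ * s → ‖w - z₀‖ < s * (‖v‖ + κ) ∧ 0 < ((w - z₀) / d).im := by
    intro w hw
    have hsv : ‖(s : ℂ) * v‖ = s * ‖v‖ := by
      rw [norm_mul, Complex.norm_real, Real.norm_eq_abs, abs_of_pos hs0]
    have e : w - z₀ = (w - c₀) + (s : ℂ) * v := by linear_combination hc₀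
    constructor
    · calc ‖w - z₀‖ = ‖(w - c₀) + (s : ℂ) * v‖ := by rw [e]
        _ ≤ ‖w - c₀‖ + ‖(s : ℂ) * v‖ := norm_add_le _ _
        _ < κ * s + s * ‖v‖ := by rw [hsv]; linarith
        _ = s * (‖v‖ + κ) := by ring
    · have hsplit : (w - z₀) / d = (s : ℂ) * (v / d) + (w - c₀) / d := by
        rw [hc₀]; field_simp; ring
      have him1 : ((s : ℂ) * (v / d)).im = s * h := by
        rw [Complex.im_ofReal_mul]
      have him2 : -(κ * s / ‖d‖) < ((w - c₀) / d).im := by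
        have hle : |((w - c₀) / d).im| ≤ ‖(w - c₀) / d‖ := Complex.abs_im_le_norm _
        have hnorm : ‖(w - c₀) / d‖ < κ * s / ‖d‖ := by
          rw [norm_div]
          exact div_lt_div_of_pos_right hw hd'
        have := neg_le_of_abs_le hle
        linarith
      rw [hsplit, Complex.add_im, him1]
      have hκd : κ * s / ‖d‖ = s * h / 2 := by
        rw [hκdef]; field_simp
      rw [hκd] at him2
      nlinarith [mul_pos hs0 hhpos]
  -- Rouché on the small disc against the linearisation
  have hrouche : ((P s).roots.filter fun w => ‖w - c₀‖ < κ * s).card = 1 := by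
    set L : ℂ[X] := C a * (X - C c₀) with hL
    have hLroots : (L.roots.filter fun w => ‖w - c₀‖ < κ * s).card = 1 := by
      rw [hL, roots_C_mul _ ha, roots_X_sub_C]
      rw [Multiset.filter_singleton, if_pos (by rw [sub_self, norm_zero]; exact hκs)]
      rfl
    rw [← hLroots]
    refine card_roots_eq_of_norm_sub_lt c₀ hκs fun w hw => ?_
    have hwz : ‖w - z₀‖ ≤ s * (‖v‖ + κ) := by
      have hsv : ‖(s : ℂ) * v‖ = s * ‖v‖ := by
        rw [norm_mul, Complex.norm_real, Real.norm_eq_abs, abs_of_pos hs0]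
      have e : w - z₀ = (w - c₀) + (s : ℂ) * v := by linear_combination hc₀
      calc ‖w - z₀‖ = ‖(w - c₀) + (s : ℂ) * v‖ := by rw [e]
        _ ≤ ‖w - c₀‖ + ‖(s : ℂ) * v‖ := norm_add_le _ _
        _ = κ * s + s * ‖v‖ := by rw [hw, hsv]
        _ = s * (‖v‖ + κ) := by ring
    obtain ⟨hw1, hw2⟩ := hηb w (hwz.trans_lt hsη)
    have hLw : L.eval w = a * (w - c₀) := by simp [hL]
    have hAw : A.eval w = (w - z₀) * Ah.eval w := by
      rw [← hfac, eval_mul, eval_sub, eval_X, eval_C]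
    have hPw : (P s).eval w - L.eval w = (w - z₀) * (Ah.eval w - a) + (s : ℂ) * (B.eval w - b) := by
      simp only [hP, eval_add, eval_mul, eval_C, hLw, hAw, hc₀, hv_def]
      field_simp
      ring
    rw [hPw, hLw, norm_mul, hw]
    calc ‖(w - z₀) * (Ah.eval w - a) + (s : ℂ) * (B.eval w - b)‖
        ≤ ‖(w - z₀) * (Ah.eval w - a)‖ + ‖(s : ℂ) * (B.eval w - b)‖ := norm_add_le _ _
      _ = ‖w - z₀‖ * ‖Ah.eval w - a‖ + s * ‖B.eval w - b‖ := by
          rw [norm_mul, norm_mul, Complex.norm_real, Real.norm_eq_abs, abs_of_pos hs0]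
      _ ≤ s * (‖v‖ + κ) * ε₁ + s * ε₂ :=
          add_le_add (mul_le_mul hwz hw1.le (norm_nonneg _) (by positivity))
            (mul_le_mul_of_nonneg_left hw2.le hs0.le)
      _ = ‖a‖ * (κ * s) / 2 := by
          rw [hε₁, hε₂]; field_simp; ring
      _ < ‖a‖ * (κ * s) := by
          have : 0 < ‖a‖ * (κ * s) := mul_pos ha' hκs
          linarith
  -- the unique root of P s near z₀ is the one in the small disc
  have hle : ((P s).roots.filter fun w => ‖w - c₀‖ < κ * s) ≤
      ((P s).roots.filter fun w => ‖w - z₀‖ < ρ) :=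
    Multiset.monotone_filter_right _ fun w hw => ((hsub w hw).1.trans hsρ)
  have heq := Multiset.eq_of_le_of_card_le hle (by rw [hrouche, hds])
  have hzin : z ∈ (P s).roots.filter fun w => ‖w - z₀‖ < ρ := Multiset.mem_filter.2 ⟨hz, hzρ⟩
  rw [← heq] at hzin
  exact (hsub z (Multiset.mem_filter.1 hzin).2).2


/-- **Real simple roots stay real.**  For a family of real polynomials `Q i` of degree `≤ n` with coefficients
continuous at `i₀` and a simple real root `x₀` of `Q i₀`, there is `ρ > 0` such that for `i` near `i₀` every complex
root of `Q i` within `ρ` of `x₀` is real (the disc holds exactly one root, and the roots of a real polynomial are closed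
under conjugation, so that root is its own conjugate). -/
theorem real_root_persists {ι : Type*} [TopologicalSpace ι] {Q : ι → ℝ[X]} {n : ℕ} {i₀ : ι}
    (hdeg : ∀ i, (Q i).natDegree ≤ n) (hcont : ∀ k, ContinuousAt (fun i => (Q i).coeff k) i₀)
    {x₀ : ℝ} (hroot : (Q i₀).IsRoot x₀) (hder : (Q i₀).derivative.eval x₀ ≠ 0) :
    ∃ ρ : ℝ, 0 < ρ ∧ ∀ᶠ i in 𝓝 i₀,
      ∀ w ∈ ((Q i).map (algebraMap ℝ ℂ)).roots, ‖w - (x₀ : ℂ)‖ < ρ → w.im = 0 := by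
  classical
  set P : ι → ℂ[X] := fun i => (Q i).map (algebraMap ℝ ℂ) with hP
  have hdegP : ∀ i, (P i).natDegree ≤ n := fun i => (natDegree_map_le).trans (hdeg i)
  have hcontP : ∀ k, ContinuousAt (fun i => (P i).coeff k) i₀ := fun k => by
    simp only [hP, coeff_map]
    exact Complex.continuous_ofReal.continuousAt.comp (hcont k)
  have hz : (P i₀).IsRoot (x₀ : ℂ) := by
    rw [IsRoot, hP, eval_map, ← Complex.coe_algebraMap, eval₂_at_apply, hroot, map_zero]
  have ha : (P i₀).derivative.eval (x₀ : ℂ) ≠ 0 := by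
    rw [hP, derivative_map, eval_map, ← Complex.coe_algebraMap, eval₂_at_apply]
    exact (map_ne_zero_iff _ (algebraMap ℝ ℂ).injective).2 hder
  obtain ⟨ρ, hρ, -, hcircle, hone⟩ := simple_root_isolated hz ha
  refine ⟨ρ, hρ, ?_⟩
  have hdisc := card_roots_ball_eventually_eq hdegP hcontP (x₀ : ℂ) hρ hcircle
  filter_upwards [hdisc] with i hi
  rw [hone] at hi
  intro w hw hwρ
  -- roots of the real polynomial P i are closed under conjugation
  have hconj : (P i).roots.map (starRingEnd ℂ) = (P i).roots := by
    have hc : (starRingEnd ℂ).comp (algebraMap ℝ ℂ) = algebraMap ℝ ℂ := by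
      ext x
      simp
    rw [hP, roots_map_of_injective_of_card_eq_natDegree (starRingEnd ℂ).injective
      IsAlgClosed.card_roots_eq_natDegree, Polynomial.map_map, hc]
  have hw' : (starRingEnd ℂ) w ∈ (P i).roots := by
    rw [← hconj]
    exact Multiset.mem_map_of_mem _ hw
  have hw'ρ : ‖(starRingEnd ℂ) w - (x₀ : ℂ)‖ < ρ := by
    rw [← Complex.conj_ofReal x₀, ← map_sub, Complex.norm_conj]
    exact hwρ
  obtain ⟨u, hu⟩ := Multiset.card_eq_one.1 hi
  have h1 : w ∈ (P i).roots.filter fun w => ‖w - (x₀ : ℂ)‖ < ρ := Multiset.mem_filter.2 ⟨hw, hwρ⟩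
  have h2 : (starRingEnd ℂ) w ∈ (P i).roots.filter fun w => ‖w - (x₀ : ℂ)‖ < ρ :=
    Multiset.mem_filter.2 ⟨hw', hw'ρ⟩
  rw [hu, Multiset.mem_singleton] at h1 h2
  have : (starRingEnd ℂ) w = w := by rw [h2, h1]
  exact Complex.conj_eq_iff_im.1 this

end TieLaw

end Summit.ValiantsHypothesis.ValiantsHypothesis.Theorems.LacunarySymmetroidMatrixDescartes
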